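import Summits.MatrixMultiplication.OmegaCensus.ThreeSetLineModFourSlice
import Summits.MatrixMultiplication.OmegaCensus.DominoZpZpScaled
import Mathlib.Data.List.GetD
import HarnessLib

/-!
# The bit-sliced MOD-4 FILTER, IV: the in-kernel bit-planes represent the block of `compsLit`

ω-census `pub-omega`, family (b3), seat pub-omega-group gen 42.  Framing: lottery ticket; floor = certified bounds/negative
ranges.  VALUE: a kernel TOOL for the three-set cube cells `(4, d, e)@p²` (`ThreeSetZpCells4Core`); NOT progress on ω.
`genPlanes_spec`: `genPlanes n j = (L, PL)` has `L = |compsLit n j|`, `n` coordinates, every plane `< 2^L`, and every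
member `l ∈ compsLit n j` is carried by some datum `k < L`: bit `k` of plane `(i, b)` is bit `b` of `l[i]` (`b < 2`) —
proved along the `compsLit` recursion (`genFold_inv`: offsets, disjoint shifted children, the constant leading entry).
`blockPlanes_spec`: the same for the block `(compsLit n j).map (pre ++ ·)` with constant prefix planes.
-/

namespace Summit.MatrixMultiplication.OmegaCensus

/-! # The generated bit-planes represent the block of `compsLit` -/

namespace LineMod

open Finset

/-- Members of `compsLit n r` have length `n` and sum `r`. [folklore] -/
theorem length_sum_of_mem_compsLit : ∀ (n r : ℕ) (l : List ℕ), l ∈ ZpZpDomino.compsLit n r → l.length = n ∧ l.sum = r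
  | 0, r, l, h => by
    unfold ZpZpDomino.compsLit at h
    by_cases hr : r = 0
    · rw [if_pos hr, List.mem_singleton] at h; subst h; subst hr; simp
    · rw [if_neg hr] at h; simp at h
  | n + 1, r, l, h => by
    rw [ZpZpDomino.compsLit, List.mem_flatMap] at h
    obtain ⟨c, hc, hl⟩ := h
    rw [List.mem_map] at hl
    obtain ⟨l', hl', rfl⟩ := hl
    rw [List.mem_range] at hc
    obtain ⟨h1, h2⟩ := length_sum_of_mem_compsLit n (r - c) l' hl'
    refine ⟨by rw [List.length_cons, h1], ?_⟩
    rw [List.sum_cons, h2]; omega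

/-- Plane `b` of coordinate `i` of a plane table. [folklore] -/
def pl (PL : List (List ℕ)) (i b : ℕ) : ℕ := (PL.getD i []).getD b 0

/-- `orShift` on cons. [folklore] -/
theorem orShift_cons (a s : List ℕ) (A S : List (List ℕ)) (off : ℕ) :
    orShift (a :: A) (s :: S) off = [a.getD 0 0 ||| (s.getD 0 0 <<< off), a.getD 1 0 ||| (s.getD 1 0 <<< off)] :: orShift A S off :=
  rfl

/-- Length of `orShift`. [folklore] -/
theorem length_orShift : ∀ (A S : List (List ℕ)) (off : ℕ), (orShift A S off).length = min A.length S.length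
  | [], S, off => by simp [orShift]
  | a :: A, [], off => by simp [orShift]
  | a :: A, s :: S, off => by rw [orShift_cons, List.length_cons, length_orShift]; simp [Nat.succ_min_succ]

/-- Planes of `orShift` inside the range. [folklore] -/
theorem pl_orShift : ∀ (A S : List (List ℕ)) (off i : ℕ), i < A.length → i < S.length → ∀ b < 2,
    pl (orShift A S off) i b = pl A i b ||| (pl S i b <<< off)
  | [], S, off, i, hi, _, _, _ => absurd hi (Nat.not_lt_zero i)
  | a :: A, [], off, i, _, hi, _, _ => absurd hi (Nat.not_lt_zero i)
  | a :: A, s :: S, off, 0, _, _, b, hb => by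
    rw [orShift_cons]; unfold pl; simp only [List.getD_cons_zero]
    interval_cases b <;> rfl
  | a :: A, s :: S, off, i + 1, hiA, hiS, b, hb => by
    rw [orShift_cons]
    have := pl_orShift A S off i (by simpa using hiA) (by simpa using hiS) b hb
    unfold pl at this ⊢
    simp only [List.getD_cons_succ]
    exact this

/-- Planes `b ≥ 2` of `orShift` vanish. [folklore] -/
theorem pl_orShift_ge : ∀ (A S : List (List ℕ)) (off i b : ℕ), 2 ≤ b → pl (orShift A S off) i b = 0
  | [], S, off, i, b, _ => by unfold pl; simp [orShift]
  | a :: A, [], off, i, b, _ => by unfold pl; simp [orShift]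
  | a :: A, s :: S, off, 0, b, hb => by
    rw [orShift_cons]; unfold pl; simp only [List.getD_cons_zero]
    obtain ⟨b', rfl⟩ := Nat.exists_eq_add_of_le hb
    rw [show 2 + b' = (b' + 1) + 1 by ring, List.getD_cons_succ, List.getD_cons_succ, List.getD_nil]
  | a :: A, s :: S, off, i + 1, b, hb => by
    rw [orShift_cons]
    have := pl_orShift_ge A S off i b hb
    unfold pl at this ⊢
    simp only [List.getD_cons_succ]
    exact this

/-- Planes beyond the table are `0`. [folklore] -/
theorem pl_of_length_le {PL : List (List ℕ)} {i : ℕ} (h : PL.length ≤ i) (b : ℕ) : pl PL i b = 0 := by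
  unfold pl; rw [List.getD_eq_default _ _ h]; rfl

/-- Planes of the all-zero table vanish. [folklore] -/
theorem pl_replicate_zero (m i b : ℕ) : pl (List.replicate m [0, 0]) i b = 0 := by
  unfold pl
  by_cases hi : i < m
  · rw [show (List.replicate m [0, 0]).getD i [] = [0, 0] from by
      rw [List.getD_eq_getElem _ _ (by simpa using hi), List.getElem_replicate]]
    rcases b with _ | _ | b <;> simp
  · rw [List.getD_eq_default (List.replicate m [0, 0]) [] (by simpa using hi)]; rfl

/-- The constant planes carry the two low bits of the constant (below `L`). [folklore] -/
theorem cstPlanes_testBit (c L off k b : ℕ) (hb : b < 2) (hk : k < L) :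
    ((cstPlanes c L off).getD b 0).testBit (off + k) = c.testBit b := by
  have hones : ∀ (q : Prop) [Decidable q], ((if q then onesOf L <<< off else 0).testBit (off + k)) = decide q := by
    intro q _
    by_cases hq : q
    · rw [if_pos hq, Nat.shiftLeft_eq, Nat.testBit_mul_two_pow]
      unfold onesOf
      rw [Nat.add_sub_cancel_left, Nat.testBit_two_pow_sub_one]
      simp [hk, hq]
    · rw [if_neg hq, Nat.zero_testBit]; simp [hq]
  unfold cstPlanes
  interval_cases b
  · simp only [List.getD_cons_zero]; rw [hones, Nat.testBit_zero]
  · simp only [List.getD_cons_succ, List.getD_cons_zero]; rw [hones, Nat.testBit_succ, Nat.testBit_zero]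

/-- The constant planes are `< 2^(L + off)`. [folklore] -/
theorem cstPlanes_lt (c L off b : ℕ) : (cstPlanes c L off).getD b 0 < 2 ^ (L + off) := by
  have hone : onesOf L <<< off < 2 ^ (L + off) := by
    rw [Nat.shiftLeft_eq, pow_add]; unfold onesOf
    exact Nat.mul_lt_mul_of_lt_of_le (Nat.sub_lt (Nat.two_pow_pos L) one_pos) le_rfl (Nat.two_pow_pos off)
  have hcase : ∀ (q : Prop) [Decidable q], (if q then onesOf L <<< off else 0) < 2 ^ (L + off) := by
    intro q _; split
    · exact hone
    · exact Nat.two_pow_pos _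
  unfold cstPlanes
  rcases b with _ | _ | b
  · simp only [List.getD_cons_zero]; exact hcase _
  · simp only [List.getD_cons_succ, List.getD_cons_zero]; exact hcase _
  · simp only [List.getD_cons_succ, List.getD_nil]; exact Nat.two_pow_pos _

/-- `forceSub sub m = sub m`. [folklore] -/
theorem forceSub_eq {α : Type} (sub : ℕ → α) (m : ℕ) : forceSub sub m = sub m := by
  cases m <;> rfl

/-- `forcePair L A = (L, A)`. [folklore] -/
theorem forcePair_eq {β : Type} (L : ℕ) (A : β) : forcePair L A = (L, A) := by
  cases L <;> rfl

/-- `genFold` step. [folklore] -/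
theorem genFold_succ (sub : ℕ → ℕ × List (List ℕ)) (n j c : ℕ) :
    genFold sub n j (c + 1) = ((genFold sub n j c).1 + (sub (j - c)).1,
      orShift (genFold sub n j c).2 (cstPlanes c (sub (j - c)).1 0 :: (sub (j - c)).2) (genFold sub n j c).1) := by
  rw [genFold]; simp only [forceSub_eq, forcePair_eq]

/-- **The `genFold` invariant**: lengths, the `2^L` bound, and the representation of every child datum. [folklore] -/
theorem genFold_inv (sub : ℕ → ℕ × List (List ℕ)) (n j : ℕ)
    (hsub : ∀ j', (sub j').1 = (ZpZpDomino.compsLit n j').length ∧ (sub j').2.length = n ∧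
      (∀ i b, pl (sub j').2 i b < 2 ^ (sub j').1) ∧
      ∀ l ∈ ZpZpDomino.compsLit n j', ∃ k < (sub j').1, ∀ i b, b < 2 → (pl (sub j').2 i b).testBit k = (l.getD i 0).testBit b) :
    ∀ c,
    (genFold sub n j c).1 = ((List.range c).flatMap fun c' => (ZpZpDomino.compsLit n (j - c')).map fun l => c' :: l).length ∧
    (genFold sub n j c).2.length = n + 1 ∧
    (∀ i b, pl (genFold sub n j c).2 i b < 2 ^ (genFold sub n j c).1) ∧
    (∀ c' < c, ∀ l' ∈ ZpZpDomino.compsLit n (j - c'), ∃ k < (genFold sub n j c).1,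
      ∀ i b, b < 2 → (pl (genFold sub n j c).2 i b).testBit k = ((c' :: l').getD i 0).testBit b)
  | 0 => by
    refine ⟨by simp [genFold], by simp [genFold], fun i b => ?_, fun c' hc' => absurd hc' (Nat.not_lt_zero _)⟩
    simp only [genFold, pow_zero, Nat.lt_one_iff]
    exact pl_replicate_zero _ _ _
  | c + 1 => by
    obtain ⟨ha, hb, hc, hd⟩ := genFold_inv sub n j hsub c
    obtain ⟨sa, sb, sc, sd⟩ := hsub (j - c)
    rw [genFold_succ]
    set off := (genFold sub n j c).1 with hoff
    set A := (genFold sub n j c).2 with hA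
    set Lc := (sub (j - c)).1 with hLc
    set PLc := (sub (j - c)).2 with hPLc
    dsimp only
    have hlenS : (cstPlanes c Lc 0 :: PLc).length = n + 1 := by rw [List.length_cons, sb]
    have hlenN : (orShift A (cstPlanes c Lc 0 :: PLc) off).length = n + 1 := by
      rw [length_orShift, hb, hlenS, min_self]
    have hnew : ∀ i b, b < 2 → i < n + 1 →
        pl (orShift A (cstPlanes c Lc 0 :: PLc) off) i b = pl A i b ||| (pl (cstPlanes c Lc 0 :: PLc) i b <<< off) :=
      fun i b hb2 hi => pl_orShift A _ off i (by rw [hb]; exact hi) (by rw [hlenS]; exact hi) b hb2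
    have hSlt : ∀ i b, pl (cstPlanes c Lc 0 :: PLc) i b < 2 ^ Lc := by
      intro i b
      rcases i with _ | i
      · unfold pl; rw [List.getD_cons_zero]; simpa using cstPlanes_lt c Lc 0 b
      · unfold pl; rw [List.getD_cons_succ]; exact sc i b
    refine ⟨?_, hlenN, ?_, ?_⟩
    · rw [List.range_succ, List.flatMap_append, List.length_append, ← ha, List.flatMap_singleton, List.length_map, sa]
    · intro i b
      by_cases hi : i < n + 1
      · by_cases hb2 : b < 2
        · rw [hnew i b hb2 hi]
          apply Nat.or_lt_two_pow
          · exact (hc i b).trans_le (Nat.pow_le_pow_right (by norm_num) (Nat.le_add_right _ _))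
          · rw [Nat.shiftLeft_eq, pow_add, mul_comm (2 ^ off)]
            exact Nat.mul_lt_mul_of_lt_of_le (hSlt i b) le_rfl (Nat.two_pow_pos off)
        · rw [pl_orShift_ge _ _ _ _ _ (by omega)]; exact Nat.two_pow_pos _
      · rw [pl_of_length_le (by rw [hlenN]; omega)]; exact Nat.two_pow_pos _
    · intro c' hc' l' hl'
      rcases Nat.lt_succ_iff_lt_or_eq.1 hc' with hlt | rfl
      · -- an old child: its bits `k < off` are untouched
        obtain ⟨k, hk, hrep⟩ := hd c' hlt l' hl'
        refine ⟨k, hk.trans_le (Nat.le_add_right _ _), fun i b hb2 => ?_⟩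
        by_cases hi : i < n + 1
        · rw [hnew i b hb2 hi, Nat.testBit_lor, hrep i b hb2, Nat.testBit_shiftLeft]
          simp [Nat.not_le.2 hk]
        · rw [pl_of_length_le (by rw [hlenN]; omega), Nat.zero_testBit,
            List.getD_eq_default _ _ (by rw [List.length_cons, (length_sum_of_mem_compsLit _ _ _ hl').1]; omega),
            Nat.zero_testBit]
      · -- the new child `c`: datum `k'` of `sub (j - c)` sits at `off + k'`
        obtain ⟨k', hk', hrep⟩ := sd l' hl'
        refine ⟨off + k', Nat.add_lt_add_left hk' _, fun i b hb2 => ?_⟩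
        by_cases hi : i < n + 1
        · rw [hnew i b hb2 hi, Nat.testBit_lor, Nat.testBit_shiftLeft,
            Nat.testBit_lt_two_pow ((hc i b).trans_le (Nat.pow_le_pow_right (by norm_num) (Nat.le_add_right _ _)))]
          simp only [ge_iff_le, Nat.le_add_right, decide_true, Bool.true_and, Bool.false_or, Nat.add_sub_cancel_left]
          rcases i with _ | i
          · unfold pl; rw [List.getD_cons_zero, List.getD_cons_zero, ← cstPlanes_testBit c' Lc 0 k' b hb2 hk', zero_add]
          · unfold pl; rw [List.getD_cons_succ, List.getD_cons_succ]; exact hrep i b hb2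
        · rw [pl_of_length_le (by rw [hlenN]; omega), Nat.zero_testBit,
            List.getD_eq_default _ _ (by rw [List.length_cons, (length_sum_of_mem_compsLit _ _ _ hl').1]; omega),
            Nat.zero_testBit]

/-- **`genPlanes n j` represents `compsLit n j`**: `L = |compsLit n j|`, `n` coordinates, all planes `< 2^L`, and every member
`l` is carried by some datum `k < L` (two low bits of every entry). [folklore] -/
theorem genPlanes_spec : ∀ n j,
    (genPlanes n j).1 = (ZpZpDomino.compsLit n j).length ∧ (genPlanes n j).2.length = n ∧
    (∀ i b, pl (genPlanes n j).2 i b < 2 ^ (genPlanes n j).1) ∧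
    ∀ l ∈ ZpZpDomino.compsLit n j, ∃ k < (genPlanes n j).1, ∀ i b, b < 2 → (pl (genPlanes n j).2 i b).testBit k = (l.getD i 0).testBit b
  | 0, j => by
    unfold genPlanes ZpZpDomino.compsLit
    by_cases hj : j = 0
    · simp only [hj, if_true]
      refine ⟨rfl, rfl, fun i b => by rw [pl_of_length_le (by simp)]; norm_num, fun l hl => ⟨0, Nat.one_pos, fun i b _ => ?_⟩⟩
      rw [List.mem_singleton] at hl; subst hl
      rw [pl_of_length_le (by simp), List.getD_nil, Nat.zero_testBit, Nat.zero_testBit]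
    · simp only [hj, if_false]
      exact ⟨rfl, rfl, fun i b => by rw [pl_of_length_le (by simp)]; norm_num, fun l hl => by simp at hl⟩
  | n + 1, j => by
    obtain ⟨ha, hb, hc, hd⟩ := genFold_inv (genPlanes n) n j (fun j' => genPlanes_spec n j') (j + 1)
    have hgen : genPlanes (n + 1) j = genFold (genPlanes n) n j (j + 1) := rfl
    rw [hgen]
    refine ⟨by rw [ha, ZpZpDomino.compsLit], hb, hc, fun l hl => ?_⟩
    rw [ZpZpDomino.compsLit, List.mem_flatMap] at hl
    obtain ⟨c, hcm, hl⟩ := hl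
    rw [List.mem_map] at hl
    obtain ⟨l', hl', rfl⟩ := hl
    exact hd c (List.mem_range.1 hcm) l' hl'

/-- **The planes of the block `(compsLit n j).map (pre ++ ·)`** represent every member (two low bits, below `L`). [folklore] -/
theorem blockPlanes_spec (pre : List ℕ) (n j : ℕ) :
    (blockPlanes pre n j).1 = (ZpZpDomino.compsLit n j).length ∧
    ∀ l ∈ ZpZpDomino.compsLit n j, ∃ k < (blockPlanes pre n j).1,
      ∀ i b, b < 2 → (pl (blockPlanes pre n j).2 i b).testBit k = ((pre ++ l).getD i 0).testBit b := by
  obtain ⟨ha, hb, _, hd⟩ := genPlanes_spec n j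
  unfold blockPlanes
  dsimp only
  refine ⟨ha, fun l hl => ?_⟩
  obtain ⟨k, hk, hrep⟩ := hd l hl
  refine ⟨k, hk, fun i b hb2 => ?_⟩
  by_cases hi : i < pre.length
  · have e1 : pl (pre.map (fun c => cstPlanes c (genPlanes n j).1 0) ++ (genPlanes n j).2) i b =
        (cstPlanes (pre[i]'hi) (genPlanes n j).1 0).getD b 0 := by
      unfold pl
      rw [List.getD_append _ _ _ _ (by rw [List.length_map]; exact hi),
        List.getD_eq_getElem (pre.map fun c => cstPlanes c (genPlanes n j).1 0) [] (by rw [List.length_map]; exact hi),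
        List.getElem_map]
    have e2 : (pre ++ l).getD i 0 = pre[i]'hi := by
      rw [List.getD_append _ _ _ _ hi, List.getD_eq_getElem pre 0 hi]
    rw [e1, e2, ← zero_add k, cstPlanes_testBit _ _ 0 k b hb2 hk]
  · push Not at hi
    obtain ⟨i', rfl⟩ := Nat.exists_eq_add_of_le hi
    have e1 : pl (List.map (fun c => cstPlanes c (genPlanes n j).1 0) pre ++ (genPlanes n j).2) (pre.length + i') b =
        pl (genPlanes n j).2 i' b := by
      unfold pl
      rw [List.getD_append_right _ _ _ _ (by rw [List.length_map]; omega), List.length_map, Nat.add_sub_cancel_left]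
    have e2 : (pre ++ l).getD (pre.length + i') 0 = l.getD i' 0 := by
      rw [List.getD_append_right _ _ _ _ (by omega), Nat.add_sub_cancel_left]
    rw [e1, e2]
    exact hrep i' b hb2

end LineMod

end Summit.MatrixMultiplication.OmegaCensus
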